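import Literature.NumberTheory.Transcendental.PhilipponZeroEstimatePrelim
import Mathlib.RingTheory.MvPolynomial.Homogeneous
import HarnessLib

/-!
# Zero estimates on commutative algebraic groups, XI: the components `loc 𝔭 𝔄` of a homogeneous ideal are homogeneous

Topic `Literature/NumberTheory/Transcendental`. Eleventh module of the discharge of
`Literature.NumberTheory.Transcendental.philippon1986_std` (D. Roy, LNM 1752, Ch. 11, §2.3:
"if `I` is homogeneous, then so are its primary components"). For the component
`loc 𝔭 𝔄 = 𝔄 ℂ[X]_𝔭 ∩ ℂ[X]` (`GaGm.loc`) of a homogeneous ideal `𝔄` at a homogeneous prime `𝔭`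
we prove homogeneity (`isHomogeneous_loc`) by the torus action instead of primary decomposition:
the scalings `scale t : X_i ↦ t X_i` (`t ∈ ℂ`) act on forms of degree `e` by `t^e`
(`homogeneousComponent_scale`), preserve homogeneous ideals (`scale_mem_of_isHomogeneous`) and
hence `loc 𝔭 𝔄`; and **a `ℂ`-subspace of `ℂ[X]` stable under `scale 2` contains the homogeneous
components of its members** (`homogeneousComponent_mem_of_scale_two_stable`, by induction on the
number of non-zero components: `scale 2 h - 2^D h` kills the top component and rescales the others
by the non-zero factors `2^e - 2^D`).

Everything is PROVED; no named facts.

## References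

* Yu. V. Nesterenko, P. Philippon (eds.), *Introduction to Algebraic Independence Theory*,
  LNM 1752, Springer 2001, Ch. 11 (D. Roy), §2.3 (86). [NesterenkoPhilippon2001]
* N. Bourbaki, *Algèbre commutative*, Ch. IV §3 no. 3 Prop. 7 (graded primary decomposition). [folklore]
-/

noncomputable section

open MvPolynomial

namespace Literature.NumberTheory.Transcendental

namespace ZeroEst

variable {N : ℕ}

attribute [local instance] MvPolynomial.gradedAlgebra

/-! ### The torus action -/

/-- **The scaling `X_i ↦ t X_i`.** [folklore] -/
def scale (t : ℂ) : MvPolynomial (Fin (N + 1)) ℂ →ₐ[ℂ] MvPolynomial (Fin (N + 1)) ℂ :=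
  aeval fun i => t • X i

/-- `scale t` on monomials: `X^m ↦ t^{|m|} X^m`. [folklore] -/
theorem scale_monomial (t : ℂ) (m : Fin (N + 1) →₀ ℕ) (a : ℂ) :
    scale t (monomial m a) = t ^ (m.sum fun _ e => e) • monomial m a := by
  classical
  rw [scale, aeval_monomial, Finsupp.prod, Finsupp.sum]
  have hprod : ∏ i ∈ m.support, (t • X i : MvPolynomial (Fin (N + 1)) ℂ) ^ m i =
      C (t ^ ∑ i ∈ m.support, m i) * ∏ i ∈ m.support, X i ^ m i := by
    simp_rw [smul_eq_C_mul, mul_pow, ← map_pow]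
    rw [Finset.prod_mul_distrib, ← map_prod, Finset.prod_pow_eq_pow_sum]
  rw [hprod, ← mul_assoc, mul_comm (algebraMap ℂ _ a), mul_assoc, smul_eq_C_mul]
  congr 1
  rw [monomial_eq, Finsupp.prod]
  rfl

/-- `scale t` on a form of degree `e` is multiplication by `t^e`. [folklore] -/
theorem scale_of_isHomogeneous (t : ℂ) {P : MvPolynomial (Fin (N + 1)) ℂ} {e : ℕ} (hP : P.IsHomogeneous e) :
    scale t P = t ^ e • P := by
  classical
  conv_lhs => rw [P.as_sum]
  rw [map_sum]
  conv_rhs => rw [P.as_sum, Finset.smul_sum]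
  refine Finset.sum_congr rfl fun m hm => ?_
  rw [scale_monomial]
  congr 2
  have h := hP (mem_support_iff.mp hm)
  rw [Finsupp.weight_apply, Finsupp.sum] at h
  rw [Finsupp.sum]
  simpa using h

/-- **`scale t` acts on the component of degree `e` by `t^e`.** [folklore] -/
theorem homogeneousComponent_scale (t : ℂ) (P : MvPolynomial (Fin (N + 1)) ℂ) (e : ℕ) :
    homogeneousComponent e (scale t P) = t ^ e • homogeneousComponent e P := by
  classical
  conv_lhs => rw [← sum_homogeneousComponent P, map_sum, map_sum]
  have hterm : ∀ j ∈ Finset.range (P.totalDegree + 1),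
      homogeneousComponent e (scale t (homogeneousComponent j P)) =
        if j = e then t ^ e • homogeneousComponent e P else 0 := by
    intro j _
    rw [scale_of_isHomogeneous t (homogeneousComponent_isHomogeneous j P), map_smul,
      homogeneousComponent_of_mem (homogeneousComponent_isHomogeneous j P)]
    by_cases h : j = e
    · subst h; simp
    · rw [if_neg (Ne.symm h), if_neg h, smul_zero]
  rw [Finset.sum_congr rfl hterm, Finset.sum_ite_eq']
  split_ifs with h
  · rfl
  · rw [Finset.mem_range, not_lt] at h
    rw [homogeneousComponent_eq_zero _ _ (by omega), smul_zero]

/-- Homogeneous ideals are stable under the scalings. [folklore] -/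
theorem scale_mem_of_isHomogeneous {I : Ideal (MvPolynomial (Fin (N + 1)) ℂ)}
    (hI : I.IsHomogeneous (homogeneousSubmodule (Fin (N + 1)) ℂ)) (t : ℂ) {P : MvPolynomial (Fin (N + 1)) ℂ}
    (hP : P ∈ I) : scale t P ∈ I := by
  classical
  rw [← sum_homogeneousComponent P, map_sum]
  refine Submodule.sum_mem _ fun j _ => ?_
  rw [scale_of_isHomogeneous t (homogeneousComponent_isHomogeneous j P), smul_eq_C_mul]
  refine Ideal.mul_mem_left _ _ ?_
  have h := hI j hP
  rw [← DirectSum.Decomposition.decompose'_eq, decomposition.decompose'_apply] at h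
  exact h

/-- `scale s (scale t P) = scale (s t) P`. [folklore] -/
theorem scale_scale (s t : ℂ) (P : MvPolynomial (Fin (N + 1)) ℂ) : scale s (scale t P) = scale (s * t) P := by
  classical
  conv_lhs => rw [← sum_homogeneousComponent P, map_sum, map_sum]
  conv_rhs => rw [← sum_homogeneousComponent P, map_sum]
  refine Finset.sum_congr rfl fun j _ => ?_
  have hj := homogeneousComponent_isHomogeneous j P
  rw [scale_of_isHomogeneous t hj, map_smul, scale_of_isHomogeneous s hj, scale_of_isHomogeneous (s * t) hj,
    smul_smul, mul_pow, mul_comm]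

/-- `scale 1 = id`. [folklore] -/
theorem scale_one (P : MvPolynomial (Fin (N + 1)) ℂ) : scale 1 P = P := by
  classical
  conv_lhs => rw [← sum_homogeneousComponent P, map_sum]
  conv_rhs => rw [← sum_homogeneousComponent P]
  refine Finset.sum_congr rfl fun j _ => ?_
  rw [scale_of_isHomogeneous 1 (homogeneousComponent_isHomogeneous j P), one_pow, one_smul]

/-! ### Subspaces stable under `scale 2` are homogeneous -/

/-- **A `ℂ`-subspace of `ℂ[X]` stable under `scale 2` contains the homogeneous components of its
members.** [folklore] -/
theorem homogeneousComponent_mem_of_scale_two_stable (L : Submodule ℂ (MvPolynomial (Fin (N + 1)) ℂ))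
    (hL : ∀ P ∈ L, scale 2 P ∈ L) {h : MvPolynomial (Fin (N + 1)) ℂ} (hh : h ∈ L) (e : ℕ) :
    homogeneousComponent e h ∈ L := by
  classical
  -- induction on the number of non-zero components among the degrees `≤ B`
  suffices key : ∀ (B k : ℕ) (h : MvPolynomial (Fin (N + 1)) ℂ), h ∈ L →
      (∀ e, B < e → homogeneousComponent e h = 0) →
      ((Finset.range (B + 1)).filter fun e => homogeneousComponent e h ≠ 0).card ≤ k →
      ∀ e, homogeneousComponent e h ∈ L by
    refine key h.totalDegree _ h hh (fun e he => homogeneousComponent_eq_zero _ _ he) le_rfl e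
  intro B k
  induction k with
  | zero =>
    intro h _ hB hcard e
    have hzero : ∀ e, homogeneousComponent e h = 0 := by
      intro e
      by_cases he : B < e
      · exact hB e he
      · by_contra hne
        have : e ∈ (Finset.range (B + 1)).filter fun e => homogeneousComponent e h ≠ 0 := by
          rw [Finset.mem_filter, Finset.mem_range]; exact ⟨by omega, hne⟩
        rw [Nat.le_zero, Finset.card_eq_zero] at hcard
        rw [hcard] at this
        exact absurd this (Finset.notMem_empty _)
    rw [hzero e]; exact L.zero_mem
  | succ k ih =>
    intro h hh hB hcard e
    set S := (Finset.range (B + 1)).filter fun e => homogeneousComponent e h ≠ 0 with hS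
    by_cases hSe : S.Nonempty
    swap
    · -- no non-zero component
      rw [Finset.not_nonempty_iff_eq_empty] at hSe
      have hzero : ∀ e, homogeneousComponent e h = 0 := by
        intro e
        by_cases he : B < e
        · exact hB e he
        · by_contra hne
          have : e ∈ S := by rw [hS, Finset.mem_filter, Finset.mem_range]; exact ⟨by omega, hne⟩
          rw [hSe] at this
          exact absurd this (Finset.notMem_empty _)
      rw [hzero e]; exact L.zero_mem
    -- the top non-zero component `D`
    set D := S.max' hSe with hD
    have hDmem : D ∈ S := Finset.max'_mem S hSe
    have hDle : ∀ e ∈ S, e ≤ D := fun e he => Finset.le_max' S e he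
    -- `ψ = scale 2 h - 2^D h`
    set ψ := scale 2 h - (2 : ℂ) ^ D • h with hψ
    have hψL : ψ ∈ L := L.sub_mem (hL h hh) (L.smul_mem _ hh)
    have hψcomp : ∀ e, homogeneousComponent e ψ = ((2 : ℂ) ^ e - 2 ^ D) • homogeneousComponent e h := by
      intro e
      rw [hψ, map_sub, map_smul, homogeneousComponent_scale, sub_smul]
    have hψB : ∀ e, B < e → homogeneousComponent e ψ = 0 := fun e he => by
      rw [hψcomp, hB e he, smul_zero]
    -- the support of `ψ` is that of `h` minus `D`
    have hψcard : ((Finset.range (B + 1)).filter fun e => homogeneousComponent e ψ ≠ 0).card ≤ k := by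
      have hsub : ((Finset.range (B + 1)).filter fun e => homogeneousComponent e ψ ≠ 0) ⊆ S.erase D := by
        intro e he
        rw [Finset.mem_filter] at he
        rw [Finset.mem_erase, hS, Finset.mem_filter]
        refine ⟨fun heD => ?_, he.1, fun h0 => he.2 (by rw [hψcomp, h0, smul_zero])⟩
        apply he.2
        rw [hψcomp, heD, sub_self, zero_smul]
      have := Finset.card_le_card hsub
      rw [Finset.card_erase_of_mem hDmem] at this
      omega
    have hψcomps := ih ψ hψL hψB hψcard
    -- components of `h` of degree `≠ D`
    have hneD : ∀ e, e ≠ D → homogeneousComponent e h ∈ L := by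
      intro e heD
      have h1 := hψcomps e
      rw [hψcomp] at h1
      have hne : ((2 : ℂ) ^ e - 2 ^ D) ≠ 0 := by
        intro h0
        rw [sub_eq_zero] at h0
        have : e = D := by
          have h2 : ((2 ^ e : ℕ) : ℂ) = ((2 ^ D : ℕ) : ℂ) := by push_cast; exact h0
          exact Nat.pow_right_injective le_rfl (by exact_mod_cast h2)
        exact heD this
      have := L.smul_mem ((2 : ℂ) ^ e - 2 ^ D)⁻¹ h1
      rwa [smul_smul, inv_mul_cancel₀ hne, one_smul] at this
    by_cases heD : e = D
    · -- `h_D = h - ∑_{e ≠ D} h_e`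
      subst heD
      have hsum : h = ∑ j ∈ Finset.range (B + 1), homogeneousComponent j h := by
        set K := max B h.totalDegree with hK
        have h1 : ∑ j ∈ Finset.range (h.totalDegree + 1), homogeneousComponent j h =
            ∑ j ∈ Finset.range (K + 1), homogeneousComponent j h :=
          Finset.sum_subset (Finset.range_mono (by omega)) fun j hj hj' => by
            rw [Finset.mem_range] at hj hj'
            exact homogeneousComponent_eq_zero _ _ (by omega)
        have h2 : ∑ j ∈ Finset.range (B + 1), homogeneousComponent j h =
            ∑ j ∈ Finset.range (K + 1), homogeneousComponent j h :=
          Finset.sum_subset (Finset.range_mono (by omega)) fun j hj hj' => by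
            rw [Finset.mem_range] at hj hj'
            exact hB j (by omega)
        rw [h2, ← h1, sum_homogeneousComponent]
      have hDr : S.max' hSe ∈ Finset.range (B + 1) := (Finset.mem_filter.mp hDmem).1
      have heq : homogeneousComponent (S.max' hSe) h =
          h - ∑ j ∈ (Finset.range (B + 1)).erase (S.max' hSe), homogeneousComponent j h := by
        rw [eq_sub_iff_add_eq, Finset.add_sum_erase (Finset.range (B + 1)) (fun j => homogeneousComponent j h) hDr,
          ← hsum]
      rw [heq]
      refine L.sub_mem hh (L.sum_mem fun j hj => hneD j (Finset.ne_of_mem_erase hj))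
    · exact hneD e heD

/-! ### Homogeneity of the components -/

/-- `loc 𝔭 𝔄` is stable under the scalings when `𝔄` and `𝔭` are homogeneous. [folklore] -/
theorem scale_mem_loc {𝔭 𝔄 : Ideal (MvPolynomial (Fin (N + 1)) ℂ)} (h𝔭 : 𝔭.IsPrime)
    (h𝔭hom : 𝔭.IsHomogeneous (homogeneousSubmodule (Fin (N + 1)) ℂ))
    (h𝔄 : 𝔄.IsHomogeneous (homogeneousSubmodule (Fin (N + 1)) ℂ)) {t : ℂ} (ht : t ≠ 0)
    {P : MvPolynomial (Fin (N + 1)) ℂ} (hP : P ∈ GaGm.loc 𝔭 h𝔭 𝔄) : scale t P ∈ GaGm.loc 𝔭 h𝔭 𝔄 := by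
  obtain ⟨Q, hQ, hQP⟩ := hP
  refine ⟨scale t Q, fun h => hQ ?_, ?_⟩
  · have := scale_mem_of_isHomogeneous h𝔭hom t⁻¹ h
    rwa [scale_scale, inv_mul_cancel₀ ht, scale_one] at this
  · rw [← map_mul]
    exact scale_mem_of_isHomogeneous h𝔄 t hQP

/-- **The components `loc 𝔭 𝔄` of a homogeneous ideal at a homogeneous prime are homogeneous.**
[cite: NesterenkoPhilippon2001, Ch. 11 §2.3 (86)] -/
theorem isHomogeneous_loc {𝔭 𝔄 : Ideal (MvPolynomial (Fin (N + 1)) ℂ)} (h𝔭 : 𝔭.IsPrime)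
    (h𝔭hom : 𝔭.IsHomogeneous (homogeneousSubmodule (Fin (N + 1)) ℂ))
    (h𝔄 : 𝔄.IsHomogeneous (homogeneousSubmodule (Fin (N + 1)) ℂ)) :
    (GaGm.loc 𝔭 h𝔭 𝔄).IsHomogeneous (homogeneousSubmodule (Fin (N + 1)) ℂ) := by
  intro e P hP
  rw [← DirectSum.Decomposition.decompose'_eq, decomposition.decompose'_apply]
  have h := homogeneousComponent_mem_of_scale_two_stable ((GaGm.loc 𝔭 h𝔭 𝔄).restrictScalars ℂ)
    (fun _ hQ => scale_mem_loc h𝔭 h𝔭hom h𝔄 two_ne_zero hQ) hP e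
  exact h

/-- Homogeneous components of members of `loc 𝔭 𝔄`. [folklore] -/
theorem homogeneousComponent_mem_loc {𝔭 𝔄 : Ideal (MvPolynomial (Fin (N + 1)) ℂ)} (h𝔭 : 𝔭.IsPrime)
    (h𝔭hom : 𝔭.IsHomogeneous (homogeneousSubmodule (Fin (N + 1)) ℂ))
    (h𝔄 : 𝔄.IsHomogeneous (homogeneousSubmodule (Fin (N + 1)) ℂ)) {P : MvPolynomial (Fin (N + 1)) ℂ}
    (hP : P ∈ GaGm.loc 𝔭 h𝔭 𝔄) (e : ℕ) : homogeneousComponent e P ∈ GaGm.loc 𝔭 h𝔭 𝔄 :=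
  homogeneousComponent_mem_of_scale_two_stable ((GaGm.loc 𝔭 h𝔭 𝔄).restrictScalars ℂ)
    (fun _ hQ => scale_mem_loc h𝔭 h𝔭hom h𝔄 two_ne_zero hQ) hP e

end ZeroEst

end Literature.NumberTheory.Transcendental
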